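import Summits.QuantumFields.QCD.Theses.SpectralDefectExtinction
import Literature.MathematicalPhysics.QuantumFieldTheory.QCD
import Literature.Analysis.InnerProduct.SchurInequality

/-!
# Stub `stub_schurCount` (S1) of the line `corner-decorrelation-deep-hole`
# (crux `WindowExtinction`, stmt-QuantumFields-18063)

Schur majorant + Chebyshev, deterministic, for every gauge field: the number of characteristic
roots `z` of the massless `r = 1` Wilson–Dirac operator `A = D_W(U,0,1)` with `|4 − z| ≥ R`,
times `R^{2n}`, is at most the squared Frobenius norm of `K_Uⁿ`, `K_U = 4·1 − A`.

Nothing about gauge fields is used: this is finite-dimensional linear algebra for an arbitrary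
complex square matrix `Y`.  The proof generalises the landed Schur inequality
(`Literature.Analysis.InnerProduct.sum_norm_sq_roots_charpoly_le`, Schur's own induction on the
dimension: unit eigenvector `v` of the adjoint, the invariant hyperplane `W = v^⊥`,
`χ_S = χ_{S|W} · (X − ⟪v, S v⟫)`) from `S` to a polynomial `q(S)`:
`Σ_{z ∈ roots χ_S} |q(z)|² ≤ Σᵢ ‖q(S) bᵢ‖²` (`schurCount_sum_roots_charpoly_aeval_le`), i.e. the
spectral-mapping form of Schur's majorant for NON-NORMAL operators; then the matrix form, the
specialisation `q = (4 − X)ⁿ`, and Markov's inequality on the multiset of roots.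
-/

noncomputable section

namespace Summit.QuantumFields.QCD.Cruxes.WindowExtinction.CornerDecorrelationDeepHole

open scoped BigOperators Topology Classical
open Filter MeasureTheory
open Literature.MathematicalPhysics.QuantumLattice Literature.MathematicalPhysics.QuantumFieldTheory
  Literature.Probability.LatticeModels
open Summit.QuantumFields.QCD.Theses.SpectralDefectExtinction

section SchurPolynomial

open scoped InnerProductSpace ComplexConjugate Matrix
open Module Polynomial Literature.Analysis.InnerProduct

universe u

/-- Restriction to an invariant submodule commutes with polynomial evaluation (applied, coerced
form): `(q(f|_W) x : M) = q(f) x` for `x ∈ W`. -/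
theorem schurCount_coe_aeval_restrict_apply {R M : Type*} [CommRing R] [AddCommGroup M]
    [Module R M] (f : M →ₗ[R] M) {W : Submodule R M} (hW : ∀ x ∈ W, f x ∈ W) (q : R[X])
    (x : W) : ((aeval (f.restrict hW) q) x : M) = (aeval f q) x := by
  induction q using Polynomial.induction_on' with
  | add p₁ p₂ h₁ h₂ =>
    rw [map_add, map_add, LinearMap.add_apply, LinearMap.add_apply, Submodule.coe_add, h₁, h₂]
  | monomial k a =>
    rw [aeval_monomial, aeval_monomial, Module.End.mul_apply, Module.End.mul_apply,
      Module.algebraMap_end_apply, Module.algebraMap_end_apply, Submodule.coe_smul,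
      Module.End.pow_restrict k hW, LinearMap.coe_restrict_apply]

/-- If `v` is a unit eigenvector of the adjoint `S†`, then `⟪v, q(S) v⟫ = q(⟪v, S v⟫)` for every
polynomial `q` (since `⟪v, Sᵏ v⟫ = ⟪(S†)ᵏ v, v⟫ = ⟪v, S v⟫ᵏ`). -/
theorem schurCount_inner_aeval_of_adjoint_eigenvector {F : Type*} [NormedAddCommGroup F]
    [InnerProductSpace ℂ F] [FiniteDimensional ℂ F] (S : F →ₗ[ℂ] F) {v : F} {θ : ℂ}
    (hv1 : ‖v‖ = 1) (hSv : LinearMap.adjoint S v = θ • v) (q : ℂ[X]) :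
    ⟪v, (aeval S q) v⟫_ℂ = q.eval ⟪v, S v⟫_ℂ := by
  set μ : ℂ := ⟪v, S v⟫_ℂ with hμ_def
  have hμ : μ = conj θ := by
    rw [hμ_def, ← LinearMap.adjoint_inner_left, hSv, inner_smul_left,
      inner_self_eq_norm_sq_to_K, hv1]
    simp
  have hk : ∀ k : ℕ, ⟪v, (S ^ k) v⟫_ℂ = μ ^ k := by
    intro k
    induction k with
    | zero =>
      rw [pow_zero, pow_zero, Module.End.one_apply, inner_self_eq_norm_sq_to_K, hv1]
      simp
    | succ k ih =>
      rw [pow_succ' S k, Module.End.mul_apply, ← LinearMap.adjoint_inner_left, hSv,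
        inner_smul_left, ih, ← hμ, pow_succ' μ k]
  induction q using Polynomial.induction_on' with
  | add p₁ p₂ h₁ h₂ => rw [map_add, LinearMap.add_apply, inner_add_right, h₁, h₂, eval_add]
  | monomial k a =>
    rw [aeval_monomial, Module.End.mul_apply, Module.algebraMap_end_apply, inner_smul_right, hk,
      eval_monomial]

/-- **Schur's majorant, polynomial (spectral-mapping) form**, for a linear endomorphism `T` of
a finite-dimensional complex inner product space, an orthonormal basis `b` and a polynomial
`q`: `Σ_{z ∈ roots χ_T} |q(z)|² ≤ Σᵢ ‖q(T) bᵢ‖²` (roots with algebraic multiplicity; `T` need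
not be normal).  Schur (1909), Satz II, by Schur's induction on the dimension. -/
theorem schurCount_sum_roots_charpoly_aeval_le {E : Type u} [NormedAddCommGroup E]
    [InnerProductSpace ℂ E] [FiniteDimensional ℂ E] {ι : Type*} [Fintype ι] (T : E →ₗ[ℂ] E)
    (b : OrthonormalBasis ι ℂ E) (q : ℂ[X]) :
    ((T.charpoly.roots).map (fun z => ‖q.eval z‖ ^ 2)).sum ≤ ∑ i, ‖(aeval T q) (b i)‖ ^ 2 := by
  suffices h : ∀ (m : ℕ) (F : Type u) [NormedAddCommGroup F] [InnerProductSpace ℂ F]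
      [FiniteDimensional ℂ F] (S : F →ₗ[ℂ] F), finrank ℂ F = m →
      ((S.charpoly.roots).map (fun z => ‖q.eval z‖ ^ 2)).sum ≤
        ∑ i, ‖(aeval S q) (stdOrthonormalBasis ℂ F i)‖ ^ 2 by
    rw [sum_norm_sq_apply_eq_of_orthonormalBasis (aeval T q) b (stdOrthonormalBasis ℂ E)]
    exact h _ E T rfl
  intro m
  induction m with
  | zero =>
    intro F _ _ _ S hF
    have h1 : S.charpoly = 1 := by
      rw [← S.charpoly_monic.natDegree_eq_zero, S.charpoly_natDegree, hF]
    simp only [h1, Polynomial.roots_one, Multiset.empty_eq_zero, Multiset.map_zero,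
      Multiset.sum_zero]
    positivity
  | succ m ih =>
    intro F _ _ _ S hF
    haveI : Nontrivial F := Module.nontrivial_of_finrank_eq_succ hF
    -- a unit eigenvector `v` of the adjoint
    obtain ⟨θ, hθ⟩ := Module.End.exists_eigenvalue (LinearMap.adjoint S)
    obtain ⟨v₀, hv₀⟩ := hθ.exists_hasEigenvector
    have hv₀ne : v₀ ≠ 0 := hv₀.2
    have hv₀eq : LinearMap.adjoint S v₀ = θ • v₀ := hv₀.apply_eq_smul
    set v : F := ((‖v₀‖⁻¹ : ℝ) : ℂ) • v₀ with hv_def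
    have hv1 : ‖v‖ = 1 := by
      rw [hv_def, norm_smul, Complex.norm_real, norm_inv, norm_norm,
        inv_mul_cancel₀ (norm_ne_zero_iff.mpr hv₀ne)]
    have hSv : LinearMap.adjoint S v = θ • v := by
      rw [hv_def, map_smul, hv₀eq, smul_comm]
    have hvne : v ≠ 0 := by
      rw [← norm_ne_zero_iff, hv1]; exact one_ne_zero
    -- the invariant hyperplane `W = v^⊥`
    set W : Submodule ℂ F := (ℂ ∙ v)ᗮ with hW_def
    have hWmem : ∀ w, w ∈ W ↔ ⟪v, w⟫_ℂ = 0 := fun w =>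
      Submodule.mem_orthogonal_singleton_iff_inner_right
    have hWinv : ∀ w ∈ W, S w ∈ W := by
      intro w hw
      rw [hWmem] at hw ⊢
      rw [← LinearMap.adjoint_inner_left, hSv, inner_smul_left, hw, mul_zero]
    have hWdim : finrank ℂ W = m := by
      have h1 := Submodule.finrank_add_finrank_orthogonal (ℂ ∙ v)
      rw [finrank_span_singleton hvne, hF, ← hW_def] at h1
      omega
    set SW : W →ₗ[ℂ] W := S.restrict hWinv with hSW_def
    set c : OrthonormalBasis (Fin (finrank ℂ W)) ℂ W := stdOrthonormalBasis ℂ W with hc_def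
    have IH := ih W SW hWdim
    -- the adapted orthonormal basis `(c, v)` of `F`
    set f : Fin (finrank ℂ W) ⊕ Unit → F := Sum.elim (fun j => (c j : F)) (fun _ => v)
      with hf_def
    have hf_on : Orthonormal ℂ f := by
      classical
      rw [orthonormal_iff_ite]
      rintro (j | u) (k | u')
      · simp only [hf_def, Sum.elim_inl, Sum.inl.injEq]
        rw [← Submodule.coe_inner, c.inner_eq_ite]
      · simp only [hf_def, Sum.elim_inl, Sum.elim_inr, reduceCtorEq, if_false]
        rw [← inner_conj_symm, (hWmem _).mp (c j).2, map_zero]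
      · simp only [hf_def, Sum.elim_inl, Sum.elim_inr, reduceCtorEq, if_false]
        exact (hWmem _).mp (c k).2
      · have huu : Sum.inr (α := Fin (finrank ℂ W)) u = Sum.inr u' :=
          congrArg Sum.inr (Subsingleton.elim u u')
        simp only [hf_def, Sum.elim_inr, huu, if_true]
        rw [inner_self_eq_norm_sq_to_K, hv1]
        simp
    have hcard : Fintype.card (Fin (finrank ℂ W) ⊕ Unit) = finrank ℂ F := by
      simp [hWdim, hF]
    set b' : OrthonormalBasis (Fin (finrank ℂ W) ⊕ Unit) ℂ F :=
      OrthonormalBasis.mk hf_on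
        (hf_on.linearIndependent.span_eq_top_of_card_eq_finrank' hcard).ge with hb'_def
    have hb' : ∀ i, b' i = f i := fun i => by rw [hb'_def, OrthonormalBasis.coe_mk]
    -- the block upper triangular matrix of `S` in the adapted basis
    set μ : ℂ := ⟪v, S v⟫_ℂ with hμ_def
    classical
    set A : Matrix (Fin (finrank ℂ W)) (Fin (finrank ℂ W)) ℂ :=
      LinearMap.toMatrix c.toBasis c.toBasis SW with hA_def
    set B : Matrix (Fin (finrank ℂ W)) Unit ℂ := Matrix.of fun j _ => ⟪(c j : F), S v⟫_ℂ
      with hB_def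
    set D : Matrix Unit Unit ℂ := Matrix.of fun _ _ => μ with hD_def
    have hM : LinearMap.toMatrix b'.toBasis b'.toBasis S = Matrix.fromBlocks A B 0 D := by
      ext i k
      rw [LinearMap.toMatrix_apply, b'.coe_toBasis_repr_apply, b'.repr_apply_apply,
        b'.coe_toBasis, hb', hb']
      rcases i with j | u <;> rcases k with k | u'
      · rw [Matrix.fromBlocks_apply₁₁, hA_def, LinearMap.toMatrix_apply,
          c.coe_toBasis_repr_apply, c.repr_apply_apply, c.coe_toBasis, Submodule.coe_inner,
          hSW_def, LinearMap.coe_restrict_apply]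
        simp [hf_def]
      · simp [Matrix.fromBlocks_apply₁₂, hf_def, hB_def]
      · rw [Matrix.fromBlocks_apply₂₁, Matrix.zero_apply]
        simpa [hf_def] using (hWmem _).mp (hWinv _ (c k).2)
      · simp [Matrix.fromBlocks_apply₂₂, hf_def, hD_def, hμ_def]
    have hDchar : D.charpoly = X - C μ := by
      rw [Matrix.charpoly, Matrix.det_unique, Matrix.charmatrix_apply_eq]
      simp [hD_def]
    have hchar : S.charpoly = SW.charpoly * (X - C μ) := by
      rw [← LinearMap.charpoly_toMatrix S b'.toBasis, hM, Matrix.charpoly_fromBlocks_zero₂₁,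
        LinearMap.charpoly_toMatrix, hDchar]
    have hroots : S.charpoly.roots = SW.charpoly.roots + {μ} := by
      rw [hchar, Polynomial.roots_mul ((SW.charpoly_monic).mul (monic_X_sub_C μ)).ne_zero,
        Polynomial.roots_X_sub_C]
    rw [hroots, Multiset.map_add, Multiset.sum_add, Multiset.map_singleton,
      Multiset.sum_singleton]
    -- the Hilbert–Schmidt side in the adapted basis
    rw [sum_norm_sq_apply_eq_of_orthonormalBasis (aeval S q) (stdOrthonormalBasis ℂ F) b',
      Fintype.sum_sum_type]
    simp only [Finset.univ_unique, Finset.sum_singleton, hb', hf_def, Sum.elim_inl,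
      Sum.elim_inr]
    have hIH' : ((SW.charpoly.roots).map (fun z => ‖q.eval z‖ ^ 2)).sum ≤
        ∑ j, ‖(aeval S q) (c j)‖ ^ 2 := by
      refine IH.trans (le_of_eq (Finset.sum_congr rfl fun j _ => ?_))
      rw [Submodule.coe_norm, hSW_def, schurCount_coe_aeval_restrict_apply]
    have hμle : ‖q.eval μ‖ ^ 2 ≤ ‖(aeval S q) v‖ ^ 2 := by
      have h := norm_inner_le_norm (𝕜 := ℂ) v ((aeval S q) v)
      rw [hv1, one_mul, schurCount_inner_aeval_of_adjoint_eigenvector S hv1 hSv q] at h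
      exact pow_le_pow_left₀ (norm_nonneg _) h 2
    exact add_le_add hIH' hμle

/-- **Schur's majorant, polynomial form, for complex square matrices**:
`Σ_{z ∈ roots χ_Y} |q(z)|² ≤ Σ_{i,j} |q(Y)_{ij}|² = ‖q(Y)‖_F²` (roots with algebraic
multiplicity, `Y` arbitrary, in particular non-normal).  Schur (1909), Satz II. -/
theorem schurCount_matrix_sum_roots_charpoly_aeval_le {n : Type*} [Fintype n] [DecidableEq n]
    (Y : Matrix n n ℂ) (q : ℂ[X]) :
    ((Y.charpoly.roots).map (fun z => ‖q.eval z‖ ^ 2)).sum ≤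
      ∑ i, ∑ j, ‖(aeval Y q) i j‖ ^ 2 := by
  -- `Matrix.toLinAlgEquiv` in the standard orthonormal basis is `Matrix.toEuclideanLin`, as an
  -- algebra equivalence (so that it commutes with `aeval`)
  have e : ∀ M : Matrix n n ℂ,
      Matrix.toLinAlgEquiv (EuclideanSpace.basisFun n ℂ).toBasis M = Matrix.toEuclideanLin M :=
    fun M => rfl
  have hT : (Matrix.toLinAlgEquiv (EuclideanSpace.basisFun n ℂ).toBasis Y).charpoly =
      Y.charpoly := by
    rw [e, Matrix.toEuclideanLin_eq_toLin_orthonormal, Matrix.charpoly_toLin]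
  have h := schurCount_sum_roots_charpoly_aeval_le
    (Matrix.toLinAlgEquiv (EuclideanSpace.basisFun n ℂ).toBasis Y) (EuclideanSpace.basisFun n ℂ) q
  rw [hT, aeval_algHom_apply (Matrix.toLinAlgEquiv (EuclideanSpace.basisFun n ℂ).toBasis) Y q,
    e] at h
  refine h.trans (le_of_eq ?_)
  rw [Finset.sum_comm]
  refine Finset.sum_congr rfl fun l _ => ?_
  rw [EuclideanSpace.norm_sq_eq]
  refine Finset.sum_congr rfl fun j _ => ?_
  simp [Matrix.toLpLin_apply]

end SchurPolynomial

section Counting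

open Polynomial

/-- **Markov's inequality on a multiset**: the number of elements `z` of `s` with
`|4 − z| ≥ R ≥ 0`, times `Rᵏ`, is at most `Σ_{z ∈ s} |4 − z|ᵏ`. -/
theorem schurCount_countP_mul_pow_le_sum (s : Multiset ℂ) {R : ℝ} (hR : 0 ≤ R) (k : ℕ) :
    (s.countP (fun z : ℂ => R ≤ ‖(4 : ℂ) - z‖) : ℝ) * R ^ k ≤
      (s.map (fun z => ‖(4 : ℂ) - z‖ ^ k)).sum := by
  induction s using Multiset.induction_on with
  | empty => simp
  | cons a s ih =>
    rw [Multiset.countP_cons, Multiset.map_cons, Multiset.sum_cons, Nat.cast_add, add_mul,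
      add_comm (‖(4 : ℂ) - a‖ ^ k)]
    refine add_le_add ih ?_
    split_ifs with h
    · rw [Nat.cast_one, one_mul]
      exact pow_le_pow_left₀ hR h k
    · rw [Nat.cast_zero, zero_mul]
      positivity

/-- **Roots outside a disc vs. the Frobenius norm of a power** (the card's
`rootsOutsideDisc_le_frobSq_pow`): for every complex square matrix `Y`, every `R ≥ 0` and every
`n`, `#{z ∈ roots χ_Y : |4 − z| ≥ R} · R^{2n} ≤ ‖(4·1 − Y)ⁿ‖_F²`.  Schur's majorant in the
polynomial form at `q = (4 − X)ⁿ`, then Markov on the multiset of roots. -/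
theorem schurCount_countP_roots_mul_pow_le_frobSq {m : Type*} [Fintype m] [DecidableEq m]
    (Y : Matrix m m ℂ) {R : ℝ} (hR : 0 ≤ R) (n : ℕ) :
    (Multiset.countP (fun z : ℂ => R ≤ ‖(4 : ℂ) - z‖) Y.charpoly.roots : ℝ) * R ^ (2 * n) ≤
      ∑ i, ∑ j, ‖(((4 : ℂ) • (1 : Matrix m m ℂ) - Y) ^ n) i j‖ ^ 2 := by
  have hq : ∀ z : ℂ, ‖(4 : ℂ) - z‖ ^ (2 * n) = ‖((C (4 : ℂ) - X) ^ n).eval z‖ ^ 2 := by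
    intro z
    rw [eval_pow, eval_sub, eval_C, eval_X, norm_pow, ← pow_mul, mul_comm]
  have hK : aeval Y ((C (4 : ℂ) - X) ^ n) = ((4 : ℂ) • (1 : Matrix m m ℂ) - Y) ^ n := by
    rw [map_pow, map_sub, aeval_C, aeval_X, Algebra.algebraMap_eq_smul_one]
  have hS := schurCount_matrix_sum_roots_charpoly_aeval_le Y ((C (4 : ℂ) - X) ^ n)
  rw [hK] at hS
  refine le_trans ?_ hS
  refine (schurCount_countP_mul_pow_le_sum Y.charpoly.roots hR (2 * n)).trans (le_of_eq ?_)
  simp_rw [hq]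

end Counting

/-- **S1 · Schur majorant + Chebyshev (deterministic, every gauge field).**  For every torus,
every `SU(3)` gauge field `U`, every radius `R > 0` and every `n ≥ 1`: the number of
characteristic roots `z` of the massless `r = 1` Wilson–Dirac operator `D_W(U,0,1)` (real or
complex, with algebraic multiplicity) with `|4 − z| ≥ R`, times `R^{2n}`, is at most the squared
Frobenius norm of the `n`-th power of the hopping operator `K_U = 4·1 − D_W(U,0,1)`.  Pure linear
algebra (`schurCount_countP_roots_mul_pow_le_frobSq` at `Y = D_W(U,0,1)`); the hypotheses
`0 < R`, `1 ≤ n` are not needed. -/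
theorem stub_schurCount :
    ∀ (L : ℕ) [NeZero L] (U : GaugeConfig 4 L ↥(Matrix.specialUnitaryGroup (Fin 3) ℂ)) (R : ℝ), 0 < R → ∀ n : ℕ, 1 ≤ n → (Multiset.countP (fun z : ℂ => R ≤ ‖(4 : ℂ) - z‖) (wilsonDirac (fundamentalRep (Fin 3)) U 0 1).charpoly.roots : ℝ) * R ^ (2 * n) ≤ (∑ i, ∑ j, ‖(((4 : ℂ) • (1 : Matrix (QuarkIdx L) (QuarkIdx L) ℂ) - wilsonDirac (fundamentalRep (Fin 3)) U 0 1) ^ n) i j‖ ^ 2) := by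
  intro L _ U R hR n _
  exact schurCount_countP_roots_mul_pow_le_frobSq (wilsonDirac (fundamentalRep (Fin 3)) U 0 1)
    hR.le n

end Summit.QuantumFields.QCD.Cruxes.WindowExtinction.CornerDecorrelationDeepHole
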